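import Mathlib.Analysis.SpecialFunctions.Sqrt
import Mathlib.Geometry.Manifold.MFDeriv.SpecificFunctions
import Mathlib.Geometry.Manifold.ContMDiff.NormedSpace
import Literature.Topology.FourManifolds.FreeS3ActionsSevenSphere
import HarnessLib

/-!
# The quaternionic Hopf fibration `S³ → S⁷ → S⁴`: discharge of
`Literature.Topology.FourManifolds.ExistsHopfActionS7`

Sibling proof file of `FreeS3ActionsSevenSphere.lean` (D-0014): the named fact
`def ExistsHopfActionS7 : Prop := ∃ (a : FreeS3ActionS7) (π : 𝕊⁷ → 𝕊⁴), a.IsOrbitMap 𝕊⁴ π`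
(Hatcher (2002), §4.2 Example 4.46; Steenrod (1951), §20) is proved here as the theorem
`ExistsHopfActionS7_holds`, by writing down the quaternionic Hopf fibration explicitly.
Users `(h : ExistsHopfActionS7)` (e.g. `Summits/SmoothPoincare4/…/SoloBlindFreeS3Actions`) are fed
`ExistsHopfActionS7_holds`.

## The construction (namespace `HopfFibration`)

Identify `ℝ⁸ = ℍ × ℍ` through `fstQ`, `sndQ`, `pairVec` (Mathlib's `Quaternion` with components
`re, imI, imJ, imK`; norms by `Quaternion.normSq`) and `ℝ⁵ = ℍ × ℝ` through `quatPart` and the last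
coordinate.

* `act q (u, v) = (q u, q v)` (`actVec`, `act`): a unit quaternion acts on `S⁷ ⊂ ℍ²` by left
  multiplication. It is jointly `C^∞` (`hopfAction.contMDiff_act`: bilinear in the ambient spaces,
  composed with Mathlib's `contMDiff_coe_sphere` and `ContMDiff.codRestrict_sphere`), an action
  (`one_act`, `mul_act`), and free (`free`: cancel `q u = u` or `q v = v` in the division ring `ℍ`).
  Packaged as `hopfAction : FreeS3ActionS7`.
* `hopfMap (u, v) = (2 ū v, |u|² − |v|²) ∈ S⁴ ⊂ ℍ × ℝ` (`hopfVec`, `hopfMap`): smooth (quadratic), lands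
  in `S⁴` because `4|ū v|² + (|u|² − |v|²)² = (|u|² + |v|²)²` (`norm_sq_hopfVec`), constant on orbits
  (`hopfMap_act`: `(qu)‾(qv) = ū q̄ q v = ū v`), and its fibres are exactly the orbits
  (`exists_act_eq_of_hopfMap_eq`: `q = u' u⁻¹`, resp. `q = v' v⁻¹` when `u = 0`).
* Local sections over the two standard trivialising sets `{u ≠ 0} = {t > -1}` and `{v ≠ 0} = {t < 1}`
  (Hatcher's `U₀`, `U₁` of Example 4.44): `secPlus (w, t) = (r, w / (2r))`, `r = √((1 + t)/2)`, and
  `secMinus (w, t) = (w̄ / (2s), s)`, `s = √((1 − t)/2)`, smooth there (`contMDiffOn_secPlus`,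
  `contMDiffOn_secMinus`) with `π ∘ σ± = id` (`hopfMap_secPlus`, `hopfMap_secMinus`). Hence `π` is
  surjective (`surjective_hopfMap`) and a SUBMERSION (`surjective_mfderiv_hopfMap`): by the chain rule
  `mfderiv π (σ p) ∘ mfderiv σ p = id` (`surjective_mfderiv_hopfMap_of_section`, Mathlib's `mfderiv_comp`,
  `Filter.EventuallyEq.mfderiv_eq`, `mfderiv_id`), and every point of a fibre is a translate `q • σ(p)`
  with `π ∘ (q • ·) = π`, `(q • ·)` smooth.
* `isOrbitMap_hopfMap` assembles the four clauses of `FreeS3ActionS7.IsOrbitMap`.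

Design: real definitions with bodies (the action, the Hopf map, the sections), all lemmas proved;
no `sorry`, no new named fact, no instance, no attribute, no notation. The `Fact`s
`finrank ℝ ℍ = 3 + 1` (the statement file's `fact_finrank_real_quaternion`, which makes
`S³ = Metric.sphere (0 : ℍ) 1` a Mathlib manifold) and `finrank ℝ ℝ⁸ = 7 + 1`, `finrank ℝ ℝ⁵ = 4 + 1`
(feeding `contMDiff_coe_sphere` / `codRestrict_sphere`) are introduced inside proofs only (`haveI`).

## References

* A. Hatcher, *Algebraic Topology*, Cambridge Univ. Press (2002), §4.2, Example 4.44 (the bundles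
  `S¹ → S²ⁿ⁺¹ → ℂPⁿ` and their trivialisations over `U_i = {z_i ≠ 0}`), Example 4.46 (the
  quaternionic Hopf bundles `S³ → S⁴ⁿ⁺³ → ℍPⁿ`; `n = 1`: `S³ → S⁷ → S⁴ = ℍP¹`). [HatcherAT2002]
* N. Steenrod, *The Topology of Fibre Bundles*, Princeton Math. Series 14 (1951), §20 (the Hopf
  fiberings). [Steenrod1951]
-/

noncomputable section

open scoped Manifold ContDiff Quaternion Topology
open Function Set Quaternion

namespace Literature.Topology.FourManifolds

namespace HopfFibration

/-! ## Coordinates: `ℝ⁸ = ℍ × ℍ` and `ℝ⁵ = ℍ × ℝ` -/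

/-- The first quaternionic coordinate `u = (x₀, x₁, x₂, x₃)` of `x ∈ ℝ⁸ = ℍ²`. [folklore] -/
def fstQ (x : EuclideanSpace ℝ (Fin 8)) : ℍ := ⟨x 0, x 1, x 2, x 3⟩

/-- The second quaternionic coordinate `v = (x₄, x₅, x₆, x₇)` of `x ∈ ℝ⁸ = ℍ²`. [folklore] -/
def sndQ (x : EuclideanSpace ℝ (Fin 8)) : ℍ := ⟨x 4, x 5, x 6, x 7⟩

/-- The point `(u, v) ∈ ℝ⁸` with quaternionic coordinates `u`, `v`. [folklore] -/
def pairVec (u v : ℍ) : EuclideanSpace ℝ (Fin 8) :=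
  !₂[u.re, u.imI, u.imJ, u.imK, v.re, v.imI, v.imJ, v.imK]

/-- `(fstQ x).re = x₀`. [folklore] -/
@[simp] private theorem fstQ_re (x : EuclideanSpace ℝ (Fin 8)) : (fstQ x).re = x 0 := rfl
/-- `(fstQ x).imI = x₁`. [folklore] -/
@[simp] private theorem fstQ_imI (x : EuclideanSpace ℝ (Fin 8)) : (fstQ x).imI = x 1 := rfl
/-- `(fstQ x).imJ = x₂`. [folklore] -/
@[simp] private theorem fstQ_imJ (x : EuclideanSpace ℝ (Fin 8)) : (fstQ x).imJ = x 2 := rfl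
/-- `(fstQ x).imK = x₃`. [folklore] -/
@[simp] private theorem fstQ_imK (x : EuclideanSpace ℝ (Fin 8)) : (fstQ x).imK = x 3 := rfl
/-- `(sndQ x).re = x₄`. [folklore] -/
@[simp] private theorem sndQ_re (x : EuclideanSpace ℝ (Fin 8)) : (sndQ x).re = x 4 := rfl
/-- `(sndQ x).imI = x₅`. [folklore] -/
@[simp] private theorem sndQ_imI (x : EuclideanSpace ℝ (Fin 8)) : (sndQ x).imI = x 5 := rfl
/-- `(sndQ x).imJ = x₆`. [folklore] -/
@[simp] private theorem sndQ_imJ (x : EuclideanSpace ℝ (Fin 8)) : (sndQ x).imJ = x 6 := rfl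
/-- `(sndQ x).imK = x₇`. [folklore] -/
@[simp] private theorem sndQ_imK (x : EuclideanSpace ℝ (Fin 8)) : (sndQ x).imK = x 7 := rfl

/-- `fstQ (u, v) = u`. [folklore] -/
@[simp] private theorem fstQ_pairVec (u v : ℍ) : fstQ (pairVec u v) = u := by
  ext <;> simp [fstQ, pairVec]

/-- `sndQ (u, v) = v`. [folklore] -/
@[simp] private theorem sndQ_pairVec (u v : ℍ) : sndQ (pairVec u v) = v := by
  ext <;> simp [sndQ, pairVec]

/-- `(fstQ x, sndQ x) = x`. [folklore] -/
@[simp] private theorem pairVec_fstQ_sndQ (x : EuclideanSpace ℝ (Fin 8)) : pairVec (fstQ x) (sndQ x) = x := by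
  ext i
  fin_cases i <;> rfl

/-- Pythagoras in `ℝ⁸ = ℍ²`: `‖(u, v)‖² = |u|² + |v|²`. [folklore] -/
private theorem norm_sq_pairVec (u v : ℍ) : ‖pairVec u v‖ ^ 2 = normSq u + normSq v := by
  simp only [EuclideanSpace.real_norm_sq_eq, Fin.sum_univ_eight, pairVec, normSq_def']
  simp
  ring

/-- `‖x‖² = |fstQ x|² + |sndQ x|²`. [folklore] -/
private theorem norm_sq_eq (x : EuclideanSpace ℝ (Fin 8)) : ‖x‖ ^ 2 = normSq (fstQ x) + normSq (sndQ x) := by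
  rw [← norm_sq_pairVec, pairVec_fstQ_sndQ]

/-- On `S⁷`: `|u|² + |v|² = 1`. [folklore] -/
private theorem normSq_add_normSq (x : Metric.sphere (0 : EuclideanSpace ℝ (Fin (7 + 1))) 1) :
    normSq (fstQ (x : EuclideanSpace ℝ (Fin 8))) + normSq (sndQ (x : EuclideanSpace ℝ (Fin 8))) = 1 := by
  rw [← norm_sq_eq, norm_eq_of_mem_sphere x, one_pow]

/-! ## The action `q • (u, v) = (q u, q v)` -/

/-- The Hopf action in coordinates: `q • (u, v) = (q u, q v)`. [folklore] -/
def actVec (q : ℍ) (x : EuclideanSpace ℝ (Fin 8)) : EuclideanSpace ℝ (Fin 8) :=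
  pairVec (q * fstQ x) (q * sndQ x)

/-- `|q • x|² = |q|² |x|²`. [folklore] -/
private theorem norm_sq_actVec (q : ℍ) (x : EuclideanSpace ℝ (Fin 8)) :
    ‖actVec q x‖ ^ 2 = normSq q * ‖x‖ ^ 2 := by
  rw [actVec, norm_sq_pairVec, map_mul, map_mul, norm_sq_eq, mul_add]

/-- A unit quaternion acting on a point of `S⁷` gives a point of `S⁷`. [folklore] -/
private theorem actVec_mem_sphere (q : UnitQuaternions) (x : Metric.sphere (0 : EuclideanSpace ℝ (Fin (7 + 1))) 1) :
    actVec (q : ℍ) (x : EuclideanSpace ℝ (Fin 8)) ∈ Metric.sphere (0 : EuclideanSpace ℝ (Fin (7 + 1))) 1 := by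
  have h : ‖actVec (q : ℍ) (x : EuclideanSpace ℝ (Fin 8))‖ ^ 2 = 1 := by
    rw [norm_sq_actVec, normSq_eq_norm_mul_self, norm_eq_of_mem_sphere q, norm_eq_of_mem_sphere x]
    norm_num
  rw [mem_sphere_zero_iff_norm]
  exact (pow_eq_one_iff_of_nonneg (norm_nonneg _) two_ne_zero).1 h

/-- **The Hopf action** of the unit quaternions on `S⁷ ⊂ ℍ²`: `q • (u, v) = (q u, q v)`
(Hatcher (2002), Example 4.46; Steenrod (1951), §20). [cite: HatcherAT2002, §4.2 Example 4.46] -/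
def act (q : UnitQuaternions) (x : Metric.sphere (0 : EuclideanSpace ℝ (Fin (7 + 1))) 1) :
    Metric.sphere (0 : EuclideanSpace ℝ (Fin (7 + 1))) 1 :=
  ⟨actVec (q : ℍ) (x : EuclideanSpace ℝ (Fin 8)), actVec_mem_sphere q x⟩

/-- The action in coordinates. [cite: HatcherAT2002, §4.2 Example 4.46] -/
@[simp] theorem coe_act (q : UnitQuaternions) (x : Metric.sphere (0 : EuclideanSpace ℝ (Fin (7 + 1))) 1) :
    ((act q x : Metric.sphere (0 : EuclideanSpace ℝ (Fin (7 + 1))) 1) : EuclideanSpace ℝ (Fin (7 + 1))) =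
      actVec (q : ℍ) (x : EuclideanSpace ℝ (Fin 8)) := rfl

/-- `1 • x = x`. [cite: HatcherAT2002, §4.2 Example 4.46] -/
theorem one_act (x : Metric.sphere (0 : EuclideanSpace ℝ (Fin (7 + 1))) 1) : act 1 x = x := by
  apply Subtype.ext
  rw [coe_act, Metric.unitSphere.coe_one, actVec, one_mul, one_mul, pairVec_fstQ_sndQ]

/-- `(p q) • x = p • (q • x)`. [cite: HatcherAT2002, §4.2 Example 4.46] -/
theorem mul_act (p q : UnitQuaternions) (x : Metric.sphere (0 : EuclideanSpace ℝ (Fin (7 + 1))) 1) :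
    act (p * q) x = act p (act q x) := by
  apply Subtype.ext
  simp only [coe_act, Metric.unitSphere.coe_mul, actVec, fstQ_pairVec, sndQ_pairVec, mul_assoc]

/-- **The Hopf action is free**: `q • x = x` forces `q = 1` (cancel `q u = u` or `q v = v` in the
division ring `ℍ`, one of `u`, `v` being non-zero on `S⁷`). [cite: HatcherAT2002, §4.2 Example 4.46] -/
theorem free (q : UnitQuaternions) (x : Metric.sphere (0 : EuclideanSpace ℝ (Fin (7 + 1))) 1)
    (h : act q x = x) : q = 1 := by
  have hx := normSq_add_normSq x
  have h' := congrArg (fun y : Metric.sphere (0 : EuclideanSpace ℝ (Fin (7 + 1))) 1 ↦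
    (y : EuclideanSpace ℝ (Fin (7 + 1)))) h
  simp only [coe_act, actVec] at h'
  have hu : (q : ℍ) * fstQ (x : EuclideanSpace ℝ (Fin 8)) = fstQ (x : EuclideanSpace ℝ (Fin 8)) := by
    have := congrArg fstQ h'
    rwa [fstQ_pairVec] at this
  have hv : (q : ℍ) * sndQ (x : EuclideanSpace ℝ (Fin 8)) = sndQ (x : EuclideanSpace ℝ (Fin 8)) := by
    have := congrArg sndQ h'
    rwa [sndQ_pairVec] at this
  apply Subtype.ext
  rw [Metric.unitSphere.coe_one]
  by_cases hu0 : fstQ (x : EuclideanSpace ℝ (Fin 8)) = 0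
  · have hv0 : sndQ (x : EuclideanSpace ℝ (Fin 8)) ≠ 0 := by
      intro hv0
      rw [hu0, hv0, map_zero] at hx
      norm_num at hx
    exact mul_left_eq_self₀.1 hv |>.resolve_right hv0
  · exact mul_left_eq_self₀.1 hu |>.resolve_right hu0

/-! ## The Hopf map `π (u, v) = (2 ū v, |u|² − |v|²)` -/

/-- The Hopf map in coordinates: `(u, v) ↦ (2 ū v, |u|² − |v|²) ∈ ℍ × ℝ = ℝ⁵`. [folklore] -/
def hopfVec (x : EuclideanSpace ℝ (Fin 8)) : EuclideanSpace ℝ (Fin 5) :=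
  !₂[2 * (star (fstQ x) * sndQ x).re, 2 * (star (fstQ x) * sndQ x).imI,
    2 * (star (fstQ x) * sndQ x).imJ, 2 * (star (fstQ x) * sndQ x).imK,
    normSq (fstQ x) - normSq (sndQ x)]

/-- The quaternionic part `w = (y₀, y₁, y₂, y₃)` of `y ∈ ℝ⁵ = ℍ × ℝ`. [folklore] -/
def quatPart (y : EuclideanSpace ℝ (Fin 5)) : ℍ := ⟨y 0, y 1, y 2, y 3⟩

/-- `(quatPart y).re = y₀`. [folklore] -/
@[simp] private theorem quatPart_re (y : EuclideanSpace ℝ (Fin 5)) : (quatPart y).re = y 0 := rfl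
/-- `(quatPart y).imI = y₁`. [folklore] -/
@[simp] private theorem quatPart_imI (y : EuclideanSpace ℝ (Fin 5)) : (quatPart y).imI = y 1 := rfl
/-- `(quatPart y).imJ = y₂`. [folklore] -/
@[simp] private theorem quatPart_imJ (y : EuclideanSpace ℝ (Fin 5)) : (quatPart y).imJ = y 2 := rfl
/-- `(quatPart y).imK = y₃`. [folklore] -/
@[simp] private theorem quatPart_imK (y : EuclideanSpace ℝ (Fin 5)) : (quatPart y).imK = y 3 := rfl

/-- The quaternionic part of `π (u, v)` is `2 ū v`. [folklore] -/
@[simp] private theorem quatPart_hopfVec (x : EuclideanSpace ℝ (Fin 8)) :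
    quatPart (hopfVec x) = (2 : ℝ) • (star (fstQ x) * sndQ x) := by
  ext <;> simp [quatPart, hopfVec]

/-- The real part of `π (u, v)` is `|u|² − |v|²`. [folklore] -/
@[simp] private theorem hopfVec_apply_four (x : EuclideanSpace ℝ (Fin 8)) :
    hopfVec x 4 = normSq (fstQ x) - normSq (sndQ x) := rfl

/-- A point of `ℝ⁵` is determined by its quaternionic part and its last coordinate. [folklore] -/
private theorem ext_five {y y' : EuclideanSpace ℝ (Fin 5)} (h : quatPart y = quatPart y') (h4 : y 4 = y' 4) :
    y = y' := by
  have h0 := congrArg (fun q : ℍ ↦ q.re) h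
  have h1 := congrArg (fun q : ℍ ↦ q.imI) h
  have h2 := congrArg (fun q : ℍ ↦ q.imJ) h
  have h3 := congrArg (fun q : ℍ ↦ q.imK) h
  simp only [quatPart_re, quatPart_imI, quatPart_imJ, quatPart_imK] at h0 h1 h2 h3
  ext i
  fin_cases i
  exacts [h0, h1, h2, h3, h4]

/-- Pythagoras in `ℝ⁵ = ℍ × ℝ`: `‖y‖² = |w|² + t²`. [folklore] -/
private theorem norm_sq_five (y : EuclideanSpace ℝ (Fin 5)) : ‖y‖ ^ 2 = normSq (quatPart y) + y 4 ^ 2 := by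
  simp only [EuclideanSpace.real_norm_sq_eq, Fin.sum_univ_five, quatPart, normSq_def']

/-- `|π x|² = ‖x‖⁴`: `4 |ū v|² + (|u|² − |v|²)² = (|u|² + |v|²)²`. [folklore] -/
private theorem norm_sq_hopfVec (x : EuclideanSpace ℝ (Fin 8)) : ‖hopfVec x‖ ^ 2 = (‖x‖ ^ 2) ^ 2 := by
  rw [norm_sq_five, quatPart_hopfVec, hopfVec_apply_four, norm_sq_eq, normSq_smul, map_mul, normSq_star]
  ring

/-- The Hopf map sends `S⁷` to `S⁴`. [folklore] -/
private theorem hopfVec_mem_sphere (x : Metric.sphere (0 : EuclideanSpace ℝ (Fin (7 + 1))) 1) :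
    hopfVec (x : EuclideanSpace ℝ (Fin 8)) ∈ Metric.sphere (0 : EuclideanSpace ℝ (Fin (4 + 1))) 1 := by
  have h : ‖hopfVec (x : EuclideanSpace ℝ (Fin 8))‖ ^ 2 = 1 := by
    rw [norm_sq_hopfVec, norm_eq_of_mem_sphere x]; norm_num
  rw [mem_sphere_zero_iff_norm]
  exact (pow_eq_one_iff_of_nonneg (norm_nonneg _) two_ne_zero).1 h

/-- **The Hopf map** `π : S⁷ → S⁴`, `π (u, v) = (2 ū v, |u|² − |v|²)` (Hatcher (2002), Example 4.46).
[cite: HatcherAT2002, §4.2 Example 4.46] -/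
def hopfMap (x : Metric.sphere (0 : EuclideanSpace ℝ (Fin (7 + 1))) 1) :
    Metric.sphere (0 : EuclideanSpace ℝ (Fin (4 + 1))) 1 :=
  ⟨hopfVec (x : EuclideanSpace ℝ (Fin 8)), hopfVec_mem_sphere x⟩

/-- The Hopf map in coordinates. [cite: HatcherAT2002, §4.2 Example 4.46] -/
@[simp] theorem coe_hopfMap (x : Metric.sphere (0 : EuclideanSpace ℝ (Fin (7 + 1))) 1) :
    ((hopfMap x : Metric.sphere (0 : EuclideanSpace ℝ (Fin (4 + 1))) 1) : EuclideanSpace ℝ (Fin (4 + 1))) =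
      hopfVec (x : EuclideanSpace ℝ (Fin 8)) := rfl

/-- **The Hopf map is constant on orbits**: `π (q u, q v) = π (u, v)` for `|q| = 1`, since
`(q u)‾ (q v) = ū q̄ q v = ū v` and `|q u|² − |q v|² = |u|² − |v|²`. [folklore] -/
private theorem hopfVec_actVec (q : UnitQuaternions) (x : EuclideanSpace ℝ (Fin 8)) :
    hopfVec (actVec (q : ℍ) x) = hopfVec x := by
  have hq : normSq (q : ℍ) = 1 := by
    rw [normSq_eq_norm_mul_self, norm_eq_of_mem_sphere q, mul_one]
  have hqq : star (q : ℍ) * (q : ℍ) = 1 := by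
    rw [star_mul_self, hq]; norm_cast
  apply ext_five
  · rw [quatPart_hopfVec, quatPart_hopfVec, actVec, fstQ_pairVec, sndQ_pairVec, star_mul, mul_assoc,
      ← mul_assoc (star (q : ℍ)), hqq, one_mul]
  · rw [hopfVec_apply_four, hopfVec_apply_four, actVec, fstQ_pairVec, sndQ_pairVec, map_mul, map_mul,
      hq, one_mul, one_mul]

/-- `π (q • x) = π x`. [cite: HatcherAT2002, §4.2 Example 4.46] -/
theorem hopfMap_act (q : UnitQuaternions) (x : Metric.sphere (0 : EuclideanSpace ℝ (Fin (7 + 1))) 1) :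
    hopfMap (act q x) = hopfMap x :=
  Subtype.ext (hopfVec_actVec q x)

/-- **The fibres of the Hopf map are the orbits**: if `π x = π y` on `S⁷` then `y = q • x` for a
unit quaternion `q` — namely `q = u' u⁻¹` if `u ≠ 0` (then `q v = v'` because `ū' v' = ū v` and
`|u'| = |u|`), and `q = v' v⁻¹` if `u = 0`. [cite: HatcherAT2002, §4.2 Example 4.46] -/
theorem exists_act_eq_of_hopfMap_eq {x y : Metric.sphere (0 : EuclideanSpace ℝ (Fin (7 + 1))) 1}
    (h : hopfMap x = hopfMap y) : ∃ q : UnitQuaternions, act q x = y := by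
  -- notation
  set u := fstQ (x : EuclideanSpace ℝ (Fin 8)) with hu
  set v := sndQ (x : EuclideanSpace ℝ (Fin 8)) with hv
  set u' := fstQ (y : EuclideanSpace ℝ (Fin 8)) with hu'
  set v' := sndQ (y : EuclideanSpace ℝ (Fin 8)) with hv'
  have hx : normSq u + normSq v = 1 := normSq_add_normSq x
  have hy : normSq u' + normSq v' = 1 := normSq_add_normSq y
  have hc : hopfVec (x : EuclideanSpace ℝ (Fin 8)) = hopfVec (y : EuclideanSpace ℝ (Fin 8)) :=
    congrArg (fun p : Metric.sphere (0 : EuclideanSpace ℝ (Fin (4 + 1))) 1 ↦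
      (p : EuclideanSpace ℝ (Fin (4 + 1)))) h
  have hw : star u * v = star u' * v' := by
    have h1 := congrArg quatPart hc
    rw [quatPart_hopfVec, quatPart_hopfVec] at h1
    exact smul_right_injective ℍ (two_ne_zero (α := ℝ)) h1
  have ht : normSq u - normSq v = normSq u' - normSq v' := by
    have h1 := congrArg (fun z : EuclideanSpace ℝ (Fin 5) ↦ z 4) hc
    simpa only [hopfVec_apply_four] using h1
  have huu : normSq u = normSq u' := by linarith
  have hvv : normSq v = normSq v' := by linarith
  -- the candidate `q`, in the two cases
  by_cases hu0 : u = 0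
  · -- `u = 0`: then `u' = 0`, `|v| = |v'| = 1`, `q = v' v⁻¹`
    have hu0' : u' = 0 := by rw [← normSq_eq_zero, ← huu, hu0, map_zero]
    have hv1 : normSq v = 1 := by rw [hu0, map_zero, zero_add] at hx; exact hx
    have hv0 : v ≠ 0 := fun h0 ↦ by rw [h0, map_zero] at hv1; exact zero_ne_one hv1
    have hq1 : ‖v' * v⁻¹‖ = 1 := by
      rw [norm_mul, norm_inv]
      have h1 : ‖v‖ = 1 := by
        have := normSq_eq_norm_mul_self v; rw [hv1] at this
        nlinarith [norm_nonneg v]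
      have h2 : ‖v'‖ = 1 := by
        have := normSq_eq_norm_mul_self v'; rw [← hvv, hv1] at this
        nlinarith [norm_nonneg v']
      rw [h1, h2, inv_one, mul_one]
    refine ⟨⟨v' * v⁻¹, mem_sphere_zero_iff_norm.2 hq1⟩, Subtype.ext ?_⟩
    rw [coe_act, ← pairVec_fstQ_sndQ (y : EuclideanSpace ℝ (Fin 8)), actVec]
    change pairVec (v' * v⁻¹ * u) (v' * v⁻¹ * v) = pairVec u' v'
    rw [hu0, hu0', mul_zero, inv_mul_cancel_right₀ hv0]
  · -- `u ≠ 0`: `q = u' u⁻¹`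
    have hnu : normSq u ≠ 0 := fun h0 ↦ hu0 (normSq_eq_zero.1 h0)
    have hu0' : u' ≠ 0 := by rw [Ne, ← normSq_eq_zero, ← huu]; exact hnu
    have hq1 : ‖u' * u⁻¹‖ = 1 := by
      rw [norm_mul, norm_inv]
      have h1 : ‖u'‖ = ‖u‖ := by
        have e1 := normSq_eq_norm_mul_self u
        have e2 := normSq_eq_norm_mul_self u'
        rw [← huu, e1] at e2
        nlinarith [norm_nonneg u, norm_nonneg u']
      rw [h1, mul_inv_cancel₀ (norm_ne_zero_iff.2 hu0)]
    refine ⟨⟨u' * u⁻¹, mem_sphere_zero_iff_norm.2 hq1⟩, Subtype.ext ?_⟩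
    rw [coe_act, ← pairVec_fstQ_sndQ (y : EuclideanSpace ℝ (Fin 8)), actVec]
    change pairVec (u' * u⁻¹ * u) (u' * u⁻¹ * v) = pairVec u' v'
    rw [inv_mul_cancel_right₀ hu0]
    congr 1
    -- `u' u⁻¹ v = v'`: from `ū' v' = ū v` and `ū u = |u|² = |u'|² = ū' u'`
    have hsu' : star u' ≠ 0 := star_ne_zero.2 hu0'
    have key : star u' * (u' * u⁻¹ * v) = star u' * v' := by
      rw [← hw, ← mul_assoc, ← mul_assoc, star_mul_self, ← huu, ← star_mul_self, mul_assoc (star u),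
        mul_inv_cancel₀ hu0, mul_one]
    exact mul_left_cancel₀ hsu' key

/-! ## Smoothness of the coordinate maps -/

/-- The four real components of a quaternion are smooth (read through Mathlib's linear isometry
`ℍ ≃ₗᵢ ℝ⁴`). [folklore] -/
private theorem contDiff_components :
    ContDiff ℝ ∞ (fun q : ℍ ↦ q.re) ∧ ContDiff ℝ ∞ (fun q : ℍ ↦ q.imI) ∧
      ContDiff ℝ ∞ (fun q : ℍ ↦ q.imJ) ∧ ContDiff ℝ ∞ (fun q : ℍ ↦ q.imK) := by
  have h := contDiff_euclidean.1 (linearIsometryEquivTuple.contDiff (n := ∞))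
  refine ⟨?_, ?_, ?_, ?_⟩
  · simpa using h 0
  · simpa using h 1
  · simpa using h 2
  · simpa using h 3

/-- A quaternion-valued map is smooth as soon as its four components are. [folklore] -/
private theorem contDiff_quat {E : Type*} [NormedAddCommGroup E] [NormedSpace ℝ E] {f : E → ℍ}
    (h0 : ContDiff ℝ ∞ fun x ↦ (f x).re) (h1 : ContDiff ℝ ∞ fun x ↦ (f x).imI)
    (h2 : ContDiff ℝ ∞ fun x ↦ (f x).imJ) (h3 : ContDiff ℝ ∞ fun x ↦ (f x).imK) : ContDiff ℝ ∞ f := by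
  have hg : ContDiff ℝ ∞ fun x ↦ (!₂[(f x).re, (f x).imI, (f x).imJ, (f x).imK] : EuclideanSpace ℝ (Fin 4)) := by
    apply PiLp.contDiff_toLp.comp
    rw [contDiff_pi]
    intro i
    fin_cases i
    · simpa using h0
    · simpa using h1
    · simpa using h2
    · simpa using h3
  have hf : f = fun x ↦ linearIsometryEquivTuple.symm
      (!₂[(f x).re, (f x).imI, (f x).imJ, (f x).imK] : EuclideanSpace ℝ (Fin 4)) := by
    funext x
    ext <;> simp
  rw [hf]
  exact linearIsometryEquivTuple.symm.contDiff.comp hg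

/-- Coordinates of `ℝ⁸` are smooth. [folklore] -/
private theorem contDiff_coord8 (i : Fin 8) : ContDiff ℝ ∞ fun x : EuclideanSpace ℝ (Fin 8) ↦ x i :=
  contDiff_euclidean.1 contDiff_id i

/-- Coordinates of `ℝ⁵` are smooth. [folklore] -/
private theorem contDiff_coord5 (i : Fin 5) : ContDiff ℝ ∞ fun y : EuclideanSpace ℝ (Fin 5) ↦ y i :=
  contDiff_euclidean.1 contDiff_id i

/-- `fstQ` is smooth (linear). [folklore] -/
private theorem contDiff_fstQ : ContDiff ℝ ∞ fstQ :=
  contDiff_quat (contDiff_coord8 0) (contDiff_coord8 1) (contDiff_coord8 2) (contDiff_coord8 3)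

/-- `sndQ` is smooth (linear). [folklore] -/
private theorem contDiff_sndQ : ContDiff ℝ ∞ sndQ :=
  contDiff_quat (contDiff_coord8 4) (contDiff_coord8 5) (contDiff_coord8 6) (contDiff_coord8 7)

/-- `quatPart` is smooth (linear). [folklore] -/
private theorem contDiff_quatPart : ContDiff ℝ ∞ quatPart :=
  contDiff_quat (contDiff_coord5 0) (contDiff_coord5 1) (contDiff_coord5 2) (contDiff_coord5 3)

/-- Quaternionic conjugation is smooth (linear). [folklore] -/
private theorem contDiff_star' : ContDiff ℝ ∞ fun q : ℍ ↦ star q := by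
  obtain ⟨h0, h1, h2, h3⟩ := contDiff_components
  exact contDiff_quat (by simpa using h0) (by simpa using h1.neg) (by simpa using h2.neg)
    (by simpa using h3.neg)

/-- `q ↦ |q|²` is smooth. [folklore] -/
private theorem contDiff_normSq : ContDiff ℝ ∞ fun q : ℍ ↦ normSq q := by
  have h : (fun q : ℍ ↦ normSq q) = fun q : ℍ ↦ ‖q‖ ^ 2 := by
    funext q; rw [normSq_eq_norm_mul_self, sq]
  rw [h]
  exact contDiff_norm_sq ℝ

/-- The real scalar `r ∈ ℝ ⊂ ℍ` is `r • 1`. [folklore] -/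
private theorem coe_eq_smul_one (r : ℝ) : (r : ℍ) = r • (1 : ℍ) := by
  ext <;> simp

/-- `(u, v) ↦ pairVec u v` is smooth (linear). [folklore] -/
private theorem contDiff_pairVec : ContDiff ℝ ∞ fun p : ℍ × ℍ ↦ pairVec p.1 p.2 := by
  obtain ⟨h0, h1, h2, h3⟩ := contDiff_components
  unfold pairVec
  apply PiLp.contDiff_toLp.comp
  rw [contDiff_pi]
  intro i
  fin_cases i
  · exact h0.comp contDiff_fst
  · exact h1.comp contDiff_fst
  · exact h2.comp contDiff_fst
  · exact h3.comp contDiff_fst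
  · exact h0.comp contDiff_snd
  · exact h1.comp contDiff_snd
  · exact h2.comp contDiff_snd
  · exact h3.comp contDiff_snd

/-- The action map `(q, x) ↦ (q u, q v)` is smooth on `ℍ × ℝ⁸` (bilinear). [folklore] -/
private theorem contDiff_actVec : ContDiff ℝ ∞ fun p : ℍ × EuclideanSpace ℝ (Fin 8) ↦ actVec p.1 p.2 :=
  contDiff_pairVec.comp ((contDiff_fst.mul (contDiff_fstQ.comp contDiff_snd)).prodMk
    (contDiff_fst.mul (contDiff_sndQ.comp contDiff_snd)))

/-- The Hopf map is smooth on `ℝ⁸` (quadratic). [folklore] -/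
private theorem contDiff_hopfVec : ContDiff ℝ ∞ hopfVec := by
  obtain ⟨h0, h1, h2, h3⟩ := contDiff_components
  have hm : ContDiff ℝ ∞ fun x : EuclideanSpace ℝ (Fin 8) ↦ star (fstQ x) * sndQ x :=
    (contDiff_star'.comp contDiff_fstQ).mul contDiff_sndQ
  unfold hopfVec
  apply PiLp.contDiff_toLp.comp
  rw [contDiff_pi]
  intro i
  fin_cases i
  · simpa using contDiff_const.mul (h0.comp hm)
  · simpa using contDiff_const.mul (h1.comp hm)
  · simpa using contDiff_const.mul (h2.comp hm)
  · simpa using contDiff_const.mul (h3.comp hm)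
  · simpa using (contDiff_normSq.comp contDiff_fstQ).sub (contDiff_normSq.comp contDiff_sndQ)

/-! ## Smoothness of the action and of the Hopf map as maps of manifolds -/

/-- `dim ℝ⁸ = 7 + 1`, the `Fact` feeding Mathlib's sphere lemmas (`contMDiff_coe_sphere`,
`ContMDiff.codRestrict_sphere`); introduced inside proofs only. [folklore] -/
private theorem fact_finrank_eight : Fact (Module.finrank ℝ (EuclideanSpace ℝ (Fin 8)) = 7 + 1) :=
  ⟨finrank_euclideanSpace_fin⟩

/-- `dim ℝ⁸ = 7 + 1` (syntactic variant). [folklore] -/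
private theorem fact_finrank_eight' : Fact (Module.finrank ℝ (EuclideanSpace ℝ (Fin (7 + 1))) = 7 + 1) :=
  ⟨finrank_euclideanSpace_fin⟩

/-- `dim ℝ⁵ = 4 + 1`. [folklore] -/
private theorem fact_finrank_five : Fact (Module.finrank ℝ (EuclideanSpace ℝ (Fin 5)) = 4 + 1) :=
  ⟨finrank_euclideanSpace_fin⟩

/-- `dim ℝ⁵ = 4 + 1` (syntactic variant). [folklore] -/
private theorem fact_finrank_five' : Fact (Module.finrank ℝ (EuclideanSpace ℝ (Fin (4 + 1))) = 4 + 1) :=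
  ⟨finrank_euclideanSpace_fin⟩

/-- **The quaternionic Hopf action** as a free smooth `S³`-action on `S⁷` (Hatcher (2002),
Example 4.46; Steenrod (1951), §20): `act` with its axioms `one_act`, `mul_act`, `free`, and the joint
smoothness `S³ × S⁷ → S⁷` (bilinear in the ambient spaces `ℍ × ℝ⁸ → ℝ⁸`, read through Mathlib's
`contMDiff_coe_sphere` and `ContMDiff.codRestrict_sphere`; the `Fact` `finrank ℝ ℍ = 3 + 1` of the
statement file is introduced inside the proof). [cite: HatcherAT2002, §4.2 Example 4.46] -/
def hopfAction : FreeS3ActionS7 where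
  act := act
  contMDiff_act := by
    haveI := fact_finrank_real_quaternion
    haveI := fact_finrank_eight; haveI := fact_finrank_eight'
    have h1 : ContMDiff ((𝓡 3).prod (𝓡 7)) 𝓘(ℝ, ℍ × EuclideanSpace ℝ (Fin 8)) ∞
        (fun p : UnitQuaternions × Metric.sphere (0 : EuclideanSpace ℝ (Fin (7 + 1))) 1 ↦
          ((p.1 : ℍ), (p.2 : EuclideanSpace ℝ (Fin 8)))) :=
      (contMDiff_coe_sphere.comp contMDiff_fst).prodMk_space (contMDiff_coe_sphere.comp contMDiff_snd)
    exact (contDiff_actVec.comp_contMDiff h1).codRestrict_sphere _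
  one_act := one_act
  mul_act := mul_act
  free := free

/-- Each `x ↦ q • x` is smooth (from the joint smoothness `hopfAction.contMDiff_act`). [folklore] -/
private theorem contMDiff_act_left (q : UnitQuaternions) : ContMDiff (𝓡 7) (𝓡 7) ∞
    (fun x : Metric.sphere (0 : EuclideanSpace ℝ (Fin (7 + 1))) 1 ↦ act q x) := by
  haveI := fact_finrank_real_quaternion
  exact hopfAction.contMDiff_act.comp (contMDiff_const.prodMk contMDiff_id)

/-- **The Hopf map is smooth** `S⁷ → S⁴`. [cite: HatcherAT2002, §4.2 Example 4.46] -/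
theorem contMDiff_hopfMap : ContMDiff (𝓡 7) (𝓡 4) ∞ hopfMap := by
  haveI := fact_finrank_eight; haveI := fact_finrank_eight'
  haveI := fact_finrank_five; haveI := fact_finrank_five'
  exact (contDiff_hopfVec.comp_contMDiff contMDiff_coe_sphere).codRestrict_sphere _

/-! ## The two local sections of the Hopf map

Over `{t > -1}` the section `σ₊ (w, t) = (r, w / (2 r))`, `r = √((1 + t) / 2)` (real first
coordinate), and over `{t < 1}` the section `σ₋ (w, t) = (w̄ / (2 s), s)`, `s = √((1 - t) / 2)`:
`π ∘ σ± = id` on these open sets, which cover `S⁴`. -/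

/-- The section over `{t > -1}` in coordinates: `(w, t) ↦ (r, (2r)⁻¹ w)`, `r = √((1 + t)/2)`.
[folklore] -/
def secPlusVec (y : EuclideanSpace ℝ (Fin 5)) : EuclideanSpace ℝ (Fin 8) :=
  pairVec (√((1 + y 4) / 2) : ℝ) (((2 * √((1 + y 4) / 2))⁻¹ : ℝ) * quatPart y)

/-- The section over `{t < 1}` in coordinates: `(w, t) ↦ ((2s)⁻¹ w̄, s)`, `s = √((1 - t)/2)`.
[folklore] -/
def secMinusVec (y : EuclideanSpace ℝ (Fin 5)) : EuclideanSpace ℝ (Fin 8) :=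
  pairVec ((((2 * √((1 - y 4) / 2))⁻¹ : ℝ) : ℍ) * star (quatPart y)) (√((1 - y 4) / 2) : ℝ)

/-- `π (σ₊ y) = y` for `y ∈ S⁴` with `t > -1`. [folklore] -/
private theorem hopfVec_secPlusVec {y : EuclideanSpace ℝ (Fin 5)} (hy : normSq (quatPart y) + y 4 ^ 2 = 1)
    (ht : -1 < y 4) : hopfVec (secPlusVec y) = y := by
  set r := √((1 + y 4) / 2) with hr
  have hr2 : r ^ 2 = (1 + y 4) / 2 := Real.sq_sqrt (by linarith)
  have hr0 : r ≠ 0 := by intro h; rw [h] at hr2; linarith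
  have h1t : 1 + y 4 ≠ 0 := by linarith
  have hw : normSq (quatPart y) = 1 - y 4 ^ 2 := by linarith
  apply ext_five
  · rw [quatPart_hopfVec, secPlusVec, fstQ_pairVec, sndQ_pairVec, star_coe, ← mul_assoc, ← coe_mul,
      coe_mul_eq_smul, smul_smul, ← hr]
    rw [show (2 : ℝ) * (r * (2 * r)⁻¹) = 1 by field_simp, one_smul]
  · rw [hopfVec_apply_four, secPlusVec, fstQ_pairVec, sndQ_pairVec, normSq_coe, map_mul, normSq_coe, hw, ← hr,
      inv_pow, mul_pow, hr2]
    field_simp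
    ring

/-- `π (σ₋ y) = y` for `y ∈ S⁴` with `t < 1`. [folklore] -/
private theorem hopfVec_secMinusVec {y : EuclideanSpace ℝ (Fin 5)} (hy : normSq (quatPart y) + y 4 ^ 2 = 1)
    (ht : y 4 < 1) : hopfVec (secMinusVec y) = y := by
  set s := √((1 - y 4) / 2) with hs
  have hs2 : s ^ 2 = (1 - y 4) / 2 := Real.sq_sqrt (by linarith)
  have hs0 : s ≠ 0 := by intro h; rw [h] at hs2; linarith
  have h1t : 1 - y 4 ≠ 0 := by linarith
  have hw : normSq (quatPart y) = 1 - y 4 ^ 2 := by linarith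
  apply ext_five
  · rw [quatPart_hopfVec, secMinusVec, fstQ_pairVec, sndQ_pairVec, star_mul, star_star, star_coe, mul_assoc,
      ← coe_mul, mul_coe_eq_smul, smul_smul, ← hs]
    rw [show (2 : ℝ) * ((2 * s)⁻¹ * s) = 1 by field_simp, one_smul]
  · rw [hopfVec_apply_four, secMinusVec, fstQ_pairVec, sndQ_pairVec, normSq_coe, map_mul, normSq_coe,
      normSq_star, hw, ← hs, inv_pow, mul_pow, hs2]
    field_simp
    ring

/-- `σ₊ y ∈ S⁷` for `y ∈ S⁴` with `t > -1`. [folklore] -/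
private theorem norm_sq_secPlusVec {y : EuclideanSpace ℝ (Fin 5)} (hy : normSq (quatPart y) + y 4 ^ 2 = 1)
    (ht : -1 < y 4) : ‖secPlusVec y‖ ^ 2 = 1 := by
  set r := √((1 + y 4) / 2) with hr
  have hr2 : r ^ 2 = (1 + y 4) / 2 := Real.sq_sqrt (by linarith)
  have hr0 : r ≠ 0 := by intro h; rw [h] at hr2; linarith
  have h1t : 1 + y 4 ≠ 0 := by linarith
  have hw : normSq (quatPart y) = 1 - y 4 ^ 2 := by linarith
  rw [secPlusVec, norm_sq_pairVec, normSq_coe, map_mul, normSq_coe, hw, ← hr, inv_pow, mul_pow, hr2]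
  field_simp
  ring

/-- `σ₋ y ∈ S⁷` for `y ∈ S⁴` with `t < 1`. [folklore] -/
private theorem norm_sq_secMinusVec {y : EuclideanSpace ℝ (Fin 5)} (hy : normSq (quatPart y) + y 4 ^ 2 = 1)
    (ht : y 4 < 1) : ‖secMinusVec y‖ ^ 2 = 1 := by
  set s := √((1 - y 4) / 2) with hs
  have hs2 : s ^ 2 = (1 - y 4) / 2 := Real.sq_sqrt (by linarith)
  have hs0 : s ≠ 0 := by intro h; rw [h] at hs2; linarith
  have h1t : 1 - y 4 ≠ 0 := by linarith
  have hw : normSq (quatPart y) = 1 - y 4 ^ 2 := by linarith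
  rw [secMinusVec, norm_sq_pairVec, map_mul, normSq_coe, normSq_star, normSq_coe, hw, ← hs, inv_pow, mul_pow,
    hs2]
  field_simp
  ring

/-- On `S⁴`: `|w|² + t² = 1`. [folklore] -/
private theorem normSq_quatPart_add_sq (y : Metric.sphere (0 : EuclideanSpace ℝ (Fin (4 + 1))) 1) :
    normSq (quatPart (y : EuclideanSpace ℝ (Fin 5))) + (y : EuclideanSpace ℝ (Fin 5)) 4 ^ 2 = 1 := by
  rw [← norm_sq_five, norm_eq_of_mem_sphere y, one_pow]

/-- The base point `(1, 0) ∈ S⁷` (junk value of the sections off their domains). [folklore] -/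
private theorem pairVec_one_zero_mem :
    pairVec 1 0 ∈ Metric.sphere (0 : EuclideanSpace ℝ (Fin (7 + 1))) 1 := by
  have h : ‖pairVec 1 0‖ ^ 2 = 1 := by rw [norm_sq_pairVec, map_one, map_zero, add_zero]
  rw [mem_sphere_zero_iff_norm]
  exact (pow_eq_one_iff_of_nonneg (norm_nonneg _) two_ne_zero).1 h

/-- The section `σ₊ : S⁴ → S⁷` over `{t > -1}` (junk value `(1, 0)` elsewhere). [folklore] -/
def secPlus (y : Metric.sphere (0 : EuclideanSpace ℝ (Fin (4 + 1))) 1) :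
    Metric.sphere (0 : EuclideanSpace ℝ (Fin (7 + 1))) 1 :=
  if h : -1 < (y : EuclideanSpace ℝ (Fin 5)) 4 then
    ⟨secPlusVec (y : EuclideanSpace ℝ (Fin 5)), by
      rw [mem_sphere_zero_iff_norm]
      exact (pow_eq_one_iff_of_nonneg (norm_nonneg _) two_ne_zero).1
        (norm_sq_secPlusVec (normSq_quatPart_add_sq y) h)⟩
  else ⟨pairVec 1 0, pairVec_one_zero_mem⟩

/-- The section `σ₋ : S⁴ → S⁷` over `{t < 1}` (junk value `(1, 0)` elsewhere). [folklore] -/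
def secMinus (y : Metric.sphere (0 : EuclideanSpace ℝ (Fin (4 + 1))) 1) :
    Metric.sphere (0 : EuclideanSpace ℝ (Fin (7 + 1))) 1 :=
  if h : (y : EuclideanSpace ℝ (Fin 5)) 4 < 1 then
    ⟨secMinusVec (y : EuclideanSpace ℝ (Fin 5)), by
      rw [mem_sphere_zero_iff_norm]
      exact (pow_eq_one_iff_of_nonneg (norm_nonneg _) two_ne_zero).1
        (norm_sq_secMinusVec (normSq_quatPart_add_sq y) h)⟩
  else ⟨pairVec 1 0, pairVec_one_zero_mem⟩

/-- `π (σ₊ y) = y` on `{t > -1}`. [cite: HatcherAT2002, §4.2 Examples 4.44 and 4.46] -/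
theorem hopfMap_secPlus {y : Metric.sphere (0 : EuclideanSpace ℝ (Fin (4 + 1))) 1}
    (hy : -1 < (y : EuclideanSpace ℝ (Fin 5)) 4) : hopfMap (secPlus y) = y := by
  apply Subtype.ext
  rw [coe_hopfMap, secPlus, dif_pos hy]
  exact hopfVec_secPlusVec (normSq_quatPart_add_sq y) hy

/-- `π (σ₋ y) = y` on `{t < 1}`. [cite: HatcherAT2002, §4.2 Examples 4.44 and 4.46] -/
theorem hopfMap_secMinus {y : Metric.sphere (0 : EuclideanSpace ℝ (Fin (4 + 1))) 1}
    (hy : (y : EuclideanSpace ℝ (Fin 5)) 4 < 1) : hopfMap (secMinus y) = y := by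
  apply Subtype.ext
  rw [coe_hopfMap, secMinus, dif_pos hy]
  exact hopfVec_secMinusVec (normSq_quatPart_add_sq y) hy

/-- **The Hopf map is surjective** (`σ₊`, `σ₋` are sections over a cover of `S⁴`). [cite: HatcherAT2002, §4.2 Examples 4.44 and 4.46] -/
theorem surjective_hopfMap : Surjective hopfMap := by
  intro y
  by_cases hy : -1 < (y : EuclideanSpace ℝ (Fin 5)) 4
  · exact ⟨secPlus y, hopfMap_secPlus hy⟩
  · exact ⟨secMinus y, hopfMap_secMinus (by linarith)⟩

/-- `{t > -1}` is open in `S⁴`. [folklore] -/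
private theorem isOpen_plusSet :
    IsOpen {y : Metric.sphere (0 : EuclideanSpace ℝ (Fin (4 + 1))) 1 | -1 < (y : EuclideanSpace ℝ (Fin 5)) 4} :=
  isOpen_lt continuous_const (((contDiff_coord5 4).continuous).comp continuous_subtype_val)

/-- `{t < 1}` is open in `S⁴`. [folklore] -/
private theorem isOpen_minusSet :
    IsOpen {y : Metric.sphere (0 : EuclideanSpace ℝ (Fin (4 + 1))) 1 | (y : EuclideanSpace ℝ (Fin 5)) 4 < 1} :=
  isOpen_lt (((contDiff_coord5 4).continuous).comp continuous_subtype_val) continuous_const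

/-- `σ₊` is smooth at the points of `{t > -1}`, read in `ℝ⁸`. [folklore] -/
private theorem contDiffAt_secPlusVec {y : EuclideanSpace ℝ (Fin 5)} (hy : -1 < y 4) :
    ContDiffAt ℝ ∞ secPlusVec y := by
  have ht : ContDiffAt ℝ ∞ (fun y : EuclideanSpace ℝ (Fin 5) ↦ (1 + y 4) / 2) y :=
    (contDiffAt_const.add (contDiff_coord5 4).contDiffAt).div_const _
  have hr : ContDiffAt ℝ ∞ (fun y : EuclideanSpace ℝ (Fin 5) ↦ √((1 + y 4) / 2)) y :=
    ht.sqrt (by change (1 + y 4) / 2 ≠ 0; intro h; linarith)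
  have hr0 : √((1 + y 4) / 2) ≠ 0 := by
    have : 0 < (1 + y 4) / 2 := by linarith
    exact (Real.sqrt_pos.2 this).ne'
  have hc : ContDiffAt ℝ ∞ (fun y : EuclideanSpace ℝ (Fin 5) ↦ (2 * √((1 + y 4) / 2))⁻¹) y :=
    (contDiffAt_const.mul hr).inv (mul_ne_zero two_ne_zero hr0)
  have hu : ContDiffAt ℝ ∞ (fun y : EuclideanSpace ℝ (Fin 5) ↦ ((√((1 + y 4) / 2) : ℝ) : ℍ)) y := by
    simp_rw [coe_eq_smul_one]; exact hr.smul contDiffAt_const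
  have hv : ContDiffAt ℝ ∞
      (fun y : EuclideanSpace ℝ (Fin 5) ↦ (((2 * √((1 + y 4) / 2))⁻¹ : ℝ) : ℍ) * quatPart y) y := by
    simp_rw [coe_eq_smul_one]; exact (hc.smul contDiffAt_const).mul contDiff_quatPart.contDiffAt
  exact contDiff_pairVec.contDiffAt.comp y (hu.prodMk hv)

/-- `σ₋` is smooth at the points of `{t < 1}`, read in `ℝ⁸`. [folklore] -/
private theorem contDiffAt_secMinusVec {y : EuclideanSpace ℝ (Fin 5)} (hy : y 4 < 1) :
    ContDiffAt ℝ ∞ secMinusVec y := by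
  have ht : ContDiffAt ℝ ∞ (fun y : EuclideanSpace ℝ (Fin 5) ↦ (1 - y 4) / 2) y :=
    (contDiffAt_const.sub (contDiff_coord5 4).contDiffAt).div_const _
  have hs : ContDiffAt ℝ ∞ (fun y : EuclideanSpace ℝ (Fin 5) ↦ √((1 - y 4) / 2)) y :=
    ht.sqrt (by change (1 - y 4) / 2 ≠ 0; intro h; linarith)
  have hs0 : √((1 - y 4) / 2) ≠ 0 := by
    have : 0 < (1 - y 4) / 2 := by linarith
    exact (Real.sqrt_pos.2 this).ne'
  have hc : ContDiffAt ℝ ∞ (fun y : EuclideanSpace ℝ (Fin 5) ↦ (2 * √((1 - y 4) / 2))⁻¹) y :=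
    (contDiffAt_const.mul hs).inv (mul_ne_zero two_ne_zero hs0)
  have hv : ContDiffAt ℝ ∞ (fun y : EuclideanSpace ℝ (Fin 5) ↦ ((√((1 - y 4) / 2) : ℝ) : ℍ)) y := by
    simp_rw [coe_eq_smul_one]; exact hs.smul contDiffAt_const
  have hu : ContDiffAt ℝ ∞
      (fun y : EuclideanSpace ℝ (Fin 5) ↦ (((2 * √((1 - y 4) / 2))⁻¹ : ℝ) : ℍ) * star (quatPart y)) y := by
    simp_rw [coe_eq_smul_one]
    exact (hc.smul contDiffAt_const).mul (contDiff_star'.comp contDiff_quatPart).contDiffAt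
  exact contDiff_pairVec.contDiffAt.comp y (hu.prodMk hv)

/-- `On`-version of Mathlib's `ContMDiff.codRestrict_sphere` (a map into a round sphere which is
smooth into the ambient space on an open set is smooth into the sphere there; cf. the same helper in
`GluckTwistUnknotProofs`). [folklore] -/
private theorem contMDiffOn_sphere_of_coe {M : Type*} [TopologicalSpace M] {H : Type*}
    [TopologicalSpace H] {E' : Type*} [NormedAddCommGroup E'] [NormedSpace ℝ E'] {IM : ModelWithCorners ℝ E' H}
    [ChartedSpace H M] [IsManifold IM ∞ M] {F : Type*} [NormedAddCommGroup F] [InnerProductSpace ℝ F]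
    {n : ℕ} [Fact (Module.finrank ℝ F = n + 1)] {s : Set M} (hs : IsOpen s)
    {g : M → Metric.sphere (0 : F) 1} (hg : ContMDiffOn IM 𝓘(ℝ, F) ∞ (fun x ↦ (g x : F)) s) :
    ContMDiffOn IM (𝓡 n) ∞ g s := by
  intro x hx
  let U : TopologicalSpace.Opens M := ⟨s, hs⟩
  have h1 : ContMDiff IM 𝓘(ℝ, F) ∞ (fun y : U ↦ (g y : F)) :=
    hg.comp_contMDiff contMDiff_subtype_val fun y ↦ y.2
  have h2 : ContMDiff IM (𝓡 n) ∞ (fun y : U ↦ g y) :=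
    h1.codRestrict_sphere (n := n) (fun y ↦ (g y).2)
  have h3 : ContMDiffAt IM (𝓡 n) ∞ g x :=
    (contMDiffAt_subtype_iff (U := U) (x := ⟨x, hx⟩)).1 (h2 _)
  exact h3.contMDiffWithinAt

/-- **`σ₊` is smooth on `{t > -1}`.** [folklore] -/
private theorem contMDiffOn_secPlus : ContMDiffOn (𝓡 4) (𝓡 7) ∞ secPlus
    {y : Metric.sphere (0 : EuclideanSpace ℝ (Fin (4 + 1))) 1 | -1 < (y : EuclideanSpace ℝ (Fin 5)) 4} := by
  haveI := fact_finrank_eight; haveI := fact_finrank_eight'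
  haveI := fact_finrank_five; haveI := fact_finrank_five'
  refine contMDiffOn_sphere_of_coe isOpen_plusSet ?_
  have h : ContMDiffOn (𝓡 4) 𝓘(ℝ, EuclideanSpace ℝ (Fin 8)) ∞
      (fun y : Metric.sphere (0 : EuclideanSpace ℝ (Fin (4 + 1))) 1 ↦ secPlusVec (y : EuclideanSpace ℝ (Fin 5)))
      {y | -1 < (y : EuclideanSpace ℝ (Fin 5)) 4} := fun y hy ↦
    ((contDiffAt_secPlusVec hy).contMDiffAt.comp y (contMDiff_coe_sphere y)).contMDiffWithinAt
  refine h.congr fun y hy ↦ ?_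
  have hy' : -1 < (y : EuclideanSpace ℝ (Fin 5)) 4 := hy
  change ((secPlus y : Metric.sphere (0 : EuclideanSpace ℝ (Fin (7 + 1))) 1) : EuclideanSpace ℝ (Fin (7 + 1))) = _
  rw [secPlus, dif_pos hy']

/-- **`σ₋` is smooth on `{t < 1}`.** [folklore] -/
private theorem contMDiffOn_secMinus : ContMDiffOn (𝓡 4) (𝓡 7) ∞ secMinus
    {y : Metric.sphere (0 : EuclideanSpace ℝ (Fin (4 + 1))) 1 | (y : EuclideanSpace ℝ (Fin 5)) 4 < 1} := by
  haveI := fact_finrank_eight; haveI := fact_finrank_eight'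
  haveI := fact_finrank_five; haveI := fact_finrank_five'
  refine contMDiffOn_sphere_of_coe isOpen_minusSet ?_
  have h : ContMDiffOn (𝓡 4) 𝓘(ℝ, EuclideanSpace ℝ (Fin 8)) ∞
      (fun y : Metric.sphere (0 : EuclideanSpace ℝ (Fin (4 + 1))) 1 ↦ secMinusVec (y : EuclideanSpace ℝ (Fin 5)))
      {y | (y : EuclideanSpace ℝ (Fin 5)) 4 < 1} := fun y hy ↦
    ((contDiffAt_secMinusVec hy).contMDiffAt.comp y (contMDiff_coe_sphere y)).contMDiffWithinAt
  refine h.congr fun y hy ↦ ?_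
  have hy' : (y : EuclideanSpace ℝ (Fin 5)) 4 < 1 := hy
  change ((secMinus y : Metric.sphere (0 : EuclideanSpace ℝ (Fin (7 + 1))) 1) : EuclideanSpace ℝ (Fin (7 + 1))) = _
  rw [secMinus, dif_pos hy']

/-! ## The Hopf map is a submersion -/

/-- **A smooth local section makes `π` submersive along it**: if `σ` is smooth on an open `U ∋ p`
and `π ∘ σ = id` on `U`, then `mfderiv π (σ p) ∘ mfderiv σ p = id` (chain rule), so
`mfderiv π (σ p)` is surjective. [folklore] -/
private theorem surjective_mfderiv_hopfMap_of_section
    {U : Set (Metric.sphere (0 : EuclideanSpace ℝ (Fin (4 + 1))) 1)} (hU : IsOpen U)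
    {σ : Metric.sphere (0 : EuclideanSpace ℝ (Fin (4 + 1))) 1 → Metric.sphere (0 : EuclideanSpace ℝ (Fin (7 + 1))) 1}
    (hσ : ContMDiffOn (𝓡 4) (𝓡 7) ∞ σ U) (hπσ : ∀ y ∈ U, hopfMap (σ y) = y)
    {p : Metric.sphere (0 : EuclideanSpace ℝ (Fin (4 + 1))) 1} (hp : p ∈ U) :
    Surjective (mfderiv (𝓡 7) (𝓡 4) hopfMap (σ p)) := by
  have hσp : MDifferentiableAt (𝓡 4) (𝓡 7) σ p :=
    ((hσ p hp).contMDiffAt (hU.mem_nhds hp)).mdifferentiableAt (by simp)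
  have hπ : MDifferentiableAt (𝓡 7) (𝓡 4) hopfMap (σ p) :=
    contMDiff_hopfMap.contMDiffAt.mdifferentiableAt (by simp)
  have h1 : mfderiv (𝓡 4) (𝓡 4) (hopfMap ∘ σ) p =
      (mfderiv (𝓡 7) (𝓡 4) hopfMap (σ p)).comp (mfderiv (𝓡 4) (𝓡 7) σ p) := mfderiv_comp p hπ hσp
  have heq : hopfMap ∘ σ =ᶠ[𝓝 p] id :=
    Filter.eventuallyEq_of_mem (hU.mem_nhds hp) fun y hy ↦ hπσ y hy
  have h2 : mfderiv (𝓡 4) (𝓡 4) (hopfMap ∘ σ) p =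
      ContinuousLinearMap.id ℝ (TangentSpace (𝓡 4) p) := by
    rw [heq.mfderiv_eq, mfderiv_id]
  intro w
  exact ⟨mfderiv (𝓡 4) (𝓡 7) σ p w, DFunLike.congr_fun (h1.symm.trans h2) w⟩

/-- **The Hopf map is a submersion**: every `mfderiv π x` is surjective. Through some point `x'`
of the fibre of `x` passes one of the smooth local sections `σ±`, so `mfderiv π x'` is surjective;
and `x = q • x'` with `π ∘ (q • ·) = π`, `(q • ·)` smooth, so by the chain rule
`mfderiv π x ∘ mfderiv (q • ·) x' = mfderiv π x'` is surjective, whence `mfderiv π x` is. [cite: HatcherAT2002, §4.2 Example 4.46] -/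
theorem surjective_mfderiv_hopfMap (x : Metric.sphere (0 : EuclideanSpace ℝ (Fin (7 + 1))) 1) :
    Surjective (mfderiv (𝓡 7) (𝓡 4) hopfMap x) := by
  obtain ⟨x', hx', hsurj⟩ : ∃ x' : Metric.sphere (0 : EuclideanSpace ℝ (Fin (7 + 1))) 1,
      hopfMap x' = hopfMap x ∧ Surjective (mfderiv (𝓡 7) (𝓡 4) hopfMap x') := by
    by_cases ht : -1 < ((hopfMap x : Metric.sphere (0 : EuclideanSpace ℝ (Fin (4 + 1))) 1) :
        EuclideanSpace ℝ (Fin 5)) 4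
    · exact ⟨secPlus (hopfMap x), hopfMap_secPlus ht, surjective_mfderiv_hopfMap_of_section
        isOpen_plusSet contMDiffOn_secPlus (fun y hy ↦ hopfMap_secPlus hy) ht⟩
    · have ht' : ((hopfMap x : Metric.sphere (0 : EuclideanSpace ℝ (Fin (4 + 1))) 1) :
          EuclideanSpace ℝ (Fin 5)) 4 < 1 := by linarith
      exact ⟨secMinus (hopfMap x), hopfMap_secMinus ht', surjective_mfderiv_hopfMap_of_section
        isOpen_minusSet contMDiffOn_secMinus (fun y hy ↦ hopfMap_secMinus hy) ht'⟩
  obtain ⟨q, hq⟩ := exists_act_eq_of_hopfMap_eq hx'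
  subst hq
  have hL : MDifferentiableAt (𝓡 7) (𝓡 7)
      (fun y : Metric.sphere (0 : EuclideanSpace ℝ (Fin (7 + 1))) 1 ↦ act q y) x' :=
    (contMDiff_act_left q).contMDiffAt.mdifferentiableAt (by simp)
  have hπ : MDifferentiableAt (𝓡 7) (𝓡 4) hopfMap (act q x') :=
    contMDiff_hopfMap.contMDiffAt.mdifferentiableAt (by simp)
  have hcomp := mfderiv_comp x' hπ hL
  have hinv : (hopfMap ∘ fun y : Metric.sphere (0 : EuclideanSpace ℝ (Fin (7 + 1))) 1 ↦ act q y) = hopfMap :=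
    funext fun y ↦ hopfMap_act q y
  rw [hinv] at hcomp
  intro w
  obtain ⟨v, hv⟩ := hsurj w
  rw [hcomp] at hv
  exact ⟨mfderiv (𝓡 7) (𝓡 7) (fun y : Metric.sphere (0 : EuclideanSpace ℝ (Fin (7 + 1))) 1 ↦ act q y) x' v, hv⟩

/-! ## Assembly -/

/-- **The Hopf map presents the standard `S⁴` as the orbit space of the Hopf action**: it is smooth,
surjective, a submersion, and its fibres are exactly the orbits. [cite: HatcherAT2002, §4.2 Example 4.46] -/
theorem isOrbitMap_hopfMap :
    hopfAction.IsOrbitMap (Metric.sphere (0 : EuclideanSpace ℝ (Fin (4 + 1))) 1) hopfMap :=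
  ⟨contMDiff_hopfMap, surjective_hopfMap, surjective_mfderiv_hopfMap, fun x _ ↦
    ⟨fun h ↦ exists_act_eq_of_hopfMap_eq h, fun ⟨q, h⟩ ↦ h ▸ (hopfMap_act q x).symm⟩⟩

end HopfFibration

/-- **Discharge of the named fact `ExistsHopfActionS7`** (Hatcher (2002), §4.2 Example 4.46;
Steenrod (1951), §20): left multiplication by unit quaternions on `S⁷ ⊂ ℍ²` is a free smooth
`S³`-action, and the Hopf map `(u, v) ↦ (2 ū v, |u|² − |v|²)` presents the standard `S⁴` as its
orbit space (`HopfFibration.hopfAction`, `HopfFibration.hopfMap`, `HopfFibration.isOrbitMap_hopfMap`).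
[cite: HatcherAT2002, §4.2 Example 4.46] -/
theorem ExistsHopfActionS7_holds : ExistsHopfActionS7 :=
  ⟨HopfFibration.hopfAction, HopfFibration.hopfMap, HopfFibration.isOrbitMap_hopfMap⟩

end Literature.Topology.FourManifolds
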